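import Summits.BirchSwinnertonDyer.Rank1Residual.F1Sign2.RaisingLawAtTwo
import Summits.BirchSwinnertonDyer.BirchSwinnertonDyer.Theses.ByReductionTypeAtTwo
import Summits.BirchSwinnertonDyer.Rank1Residual.F1Sign2.EggLemmaAtTwoProofs
import Literature.NumberTheory.EllipticCurves.CyclotomicIwasawaMainTheoremIrreducibleBaseChangeProofs
import HarnessLib.Audit.Tags
import HarnessLib

/-!
# ES-51 (-es g40, cell `bsd-f1-sign2`, crux `RankOneAtTwoBigImageOddLocal` = stmt-23715) — THE KUMMER TANGENT LAW AT `2`: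
# «the mod-`4` defect of a mod-`2` congruence at minimal level is the Kummer class of the generator»
# (sketch; statements + two kernel glues; nothing here proves BSD; PARTITION unchanged 52421 = 17880 + 27650 + 3440 + 3451)

THE OBJECT.  `W/ℚ` on the 23715 slice (non-CM, `ρ_{W,2^∞}` onto, odd torsion, odd Tamagawa product, analytic rank `1`) with `Ш(W)[2] = 0` and
`g ∈ W(ℚ) ∖ 2W(ℚ)`; `F/ℚ` a curve of the SAME conductor `N` with `F[2] ≅ W[2]` (typed: `a_p(W) ≡ a_p(F) (mod 2)` off `2N`) and `Sel₂(F) = 0`.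
By the cell's mod-`4` dictionary (ES-29 (T1)–(T3), MEMO-es §29; K41 of MEMO-an §27) `ρ_{F,4} = (1 + 2(h·1 + ι∘c))·ρ_{W,4}` with `h` a quadratic
character and `[c] = β(W,F) = γ_W·γ_F ∈ H¹(ℚ, W[2])`, `γ_E = −Δ_E f_E'(θ_E)`, and at a transposition prime `ℓ ∤ 2N` (`(Δ_W/ℓ) = −1`, so `a_ℓ` even)
`a_ℓ(W) − a_ℓ(F) ≡ 2·[Frob_ℓ is a 4-cycle in the S₄-field of c] (mod 4)`.  The Kummer class `κ(g) = x(g) − θ` has 4-cycle bit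
`ν_ℓ(g) = [g ∉ 2W(ℚ_ℓ)]` = `¬ LocallyTwoPowDivisible W ℓ 1 g` — the SUPPLY BIT of ES-47/ES-48 (class-A twins, `FourCycleLawAtTwo`).

ES-51K `KummerTangentDichotomyAtTwo` (LAW, census K51B/K51D, 3145/3145 pairs N < 10⁴): for `W` TAME AT 2 (`Δ_W < 0`, or multiplicative at `2`, or good supersingular at `2`)
and `F` with odd Tamagawa product, `β(W,F) ∈ {0, κ(g)}`.  In traces: EITHER `4 ∣ a_ℓ(W) − a_ℓ(F)` at every transposition prime `ℓ ∤ 2N` (the congruence lifts mod `4` up to a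
quadratic twist), OR at every such `ℓ`: `4 ∣ a_ℓ(W) − a_ℓ(F) ⟺ g ∈ 2W(ℚ_ℓ)`.  ES-51K♮ `KummerTangentDichotomyAtTwoSharp` = the branch `Δ_W < 0 ∧ W(ℚ₂)[2] = 0` (1547/1547),
where the count below makes it a THEOREM-CANDIDATE (no local span lemma at `2` needed).  ES-51P `SelmerParityRigidityAtTwo`: for `Δ < 0` and `W` multiplicative or supersingular
at `2`, hygienic congruent curves of the same conductor have the same `#Sel₂` (762/762 classes) — the `Σ = ∅` case of the same count.
MECHANISM (why, and why there are exceptions — a Greenberg–Wiles count, no `R = 𝕋`).  Identify `V := W[2] = F[2]`; let `L_v(W), L_v(F) ⊂ H¹(ℚ_v, V)` be the two Kummer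
Lagrangians, `Σ := {v : L_v(W) ≠ L_v(F)} ⊂ {∞, 2} ∪ {p ∣ N with V^{G_p} ≠ 0}`, `𝒰_v := L_v(W) + L_v(F)`, `𝒰^⊥_v = L_v(W) ∩ L_v(F)`.  Greenberg–Wiles gives
`dim H¹_𝒰 − dim H¹_{𝒰^⊥} = d(W,F) := Σ_{v ∈ Σ} dim L_v(F)/(L_v(W) ∩ L_v(F))` and the parity lemma `dim Sel₂(W) − dim Sel₂(F) ≡ d (mod 2)`; with `Sel₂(F) = 0` one has
`H¹_{𝒰^⊥} = 0`, `dim H¹_𝒰 = d` odd, `Sel₂(W) = ⟨κ(g)⟩ ⊂ H¹_𝒰`.  LOCAL SPAN LEMMA (the one genuinely local input; verified here at `v = ∞` in all six real-flag cases via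
«conj acts on `E[4]` as `1 + 2δ_E`, `δ_E` = the projector with kernel `⟨T₃(E)⟩` (identity component) and image `⟨T₁(E)⟩ = L_∞(E)` (smallest root)», trivial at good odd `v`,
to be checked at `2` and at multiplicative primes): `res_v β(W,F) ∈ L_v(W) + L_v(F)` for every `v`.  Hence `β ∈ H¹_𝒰`, and **when the two Kummer structures differ minimally
(`d(W,F) = 1`) the dichotomy `β ∈ {0, κ(g)}` is FORCED**; exceptions need `d ≥ 3`, i.e. (for `W(ℚ₂)[2] = 0`) at least three places where the local conditions of `W` and `F`
differ — necessarily `Δ_W > 0` (the place `∞`), the place `2`, and a multiplicative prime.  (37a1/37b1 worked example: the Galois bijection of 2-torsion is `θ_F = −3 − 3θ_W + 4θ_W²`,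
real-flag case D: `β_∞ = T₁(W) ≠ 0` and real scalar twist — matching `β = κ((0,0))`, `(0,0)` on the egg.)  Only the inclusion «a class with prescribed local behaviour lies in a
Selmer group of known dimension» is used, never `R = 𝕋`.  REGIMES (census N < 10⁴, K51D kit j344844): `Δ_W < 0` ⇒ `Σ ⊂ {2}`, `d = d₂` odd; if moreover `W(ℚ₂)[2] = 0`
then `d₂ ≤ 1` forces `L₂(W) ≠ L₂(F)`, `𝒰₂ = H¹(ℚ₂, V)` and NO span lemma is needed (ES-51K♮, 1547/1547); `W` multiplicative or supersingular at `2` ⇒ `L₂(W) = L₂(F)` (Tate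
canonical subgroup / flat), `Σ ⊂ {∞}` (1172/1172, 237/237; and for `Δ < 0`: `Σ = ∅`, `Sel₂(W) = Sel₂(F)` — ES-51P, which is why NO rank-1/rank-0 hygienic congruence of the
same conductor with `Δ < 0` is multiplicative or supersingular at `2`: 0 of 762 classes); `Δ_W > 0` and additive at `2`: the span lemma FAILS at `2` (125 exceptions with
`W(ℚ₂)[2] = 0`, real-flag cases B/F, e.g. 2368q1/2368l1 — so the earlier prediction M2 «every exception has a `ℚ₂`-rational 2-torsion point» is FALSE and is withdrawn);
`Δ_W > 0` good ordinary at `2`: `d = 3` occurs (4/116, e.g. 2089).  Real-flag law (K51D, all oriented pairs): case C (`T₁(F) = T₃(W)`, `π = (13)`) ↦ `β = 0` 1003/1011, case D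
(`π` the 3-cycle `1→3`) ↦ `β = κ(g)` with `g` on the egg 898/898, cases A/E ↦ 85+8 / 0+114, cases B/F carry every `Δ > 0` exception (105/105, 77/77 of verdict «other»);
this is the `∞`-adic half of the span lemma, `β_∞ ∈ {0, T₁(W), T₃(W)}` by case, acting exactly as computed; (out of reach at `2` for dihedral `ρ̄`: Dummigan, JTNB 18 (2006) = doi:10.5802/jtnb.548 §1; Calegari–Emerton
arXiv:math/0503359); the count is the one of Mazur–Rubin for twists (arXiv:1203.0620 is the mod-4 ⇒ companion direction: Thm 8 needs `E₁[4] ≅ E₂[4]` and potentially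
multiplicative reduction at `2`; ES-51 is one level below — the mod-4 DEFECT of a mod-2 congruence is Selmer).
ES-51S `SupplyIsModFourDefectAtTwo` (its corollary under ES-48M, kernel glue `supplyIsModFourDefect_of_laws` below): in the second branch the CLASS-A
TWINS of `W` (ES-48M: `r_an(W^{(ℓ*)}) = 0 ∧ #Ш_an(W^{(ℓ*)})` odd) are EXACTLY the transposition primes at which the congruence `W ≡ F (mod 2)` does
NOT lift mod `4`: the supplying primes of the -es line become computable from `a_ℓ mod 4` of a congruent pair, with no `L`-value and no modular symbol.
ES-51V (class form, informal here; K51B tables): in a mod-`2` congruence class of conductor-`N` curves all of whose members are hygienic (S₃ image,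
odd Tamagawa product, odd torsion, `Ш[2] = 0`) the `4`-division classes `γ_i` fall into at most `2^{r}` cosets «4-congruent up to twist», `r` = the
common `2`-Selmer rank of the positive-rank members, adjacent cosets differing by a generator's Kummer class; an all-rank-`0` hygienic class is ONE
coset (smoke K51B, `N < 450`: 41/41), i.e. A MOD-4 INCONGRUENCE BETWEEN TWO `Sel₂`-TRIVIAL CONGRUENT CURVES MAKES A RATIONAL POINT OF A THIRD MEMBER
VISIBLE (189c1 ≢ 189d1 (mod 4) is the point (of infinite order) of 189a1).

DATA (BC5 witness; engines: exact square classes in the cubic field `K₃ = ℚ(W[2])` (Sage/PARI `nfroots` + `issquare`) AND Frobenius digits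
`(a_ℓ(W) − a_ℓ(F))/2 mod 2` vs `ν_ℓ(g)` by two engines (division points over `𝔽_ℓ`; Legendre symbol of `x(g) − e_ℓ`), `ℓ < 2000`):
* 37a1/37b1 (pure python, hub-local, seconds): `ℓ < 2600`: transposition primes `d = ν` 192/192, 3-cycle primes `d = 0` 126/126, split `d = 0` 58/58;
  three-way with the MT48 census rows of 37a1 (`ℓ < 600`, `w₀ = +1`): class A ⟺ `a_ℓ(37a) ≢ a_ℓ(37b) (mod 4)`: 27/27 (14 class-A, 13 not).
* kit j344645 (K51 smoke, `N < 600`, 639 congruent pairs): strict population (slice `W` with `dim Sel₂(W) = 1`, `F` of the same conductor with `Sel₂(F) = 0`):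
  `β ∈ {0, κ(g_W)}` 47/47 (30 `κ`, 17 zero, 0 outside); `W` not clean (even Tamagawa / Ш / not slice): 47 of 533 pairs outside the point span — hygiene is load-bearing.
* kit j344648 (K51B smoke, per class, `N < 450`, 144 classes): hygienic classes 83: all-rank-0 ⇒ one coset 41/41; with a rank-1 member: 15 one coset,
  26 two cosets differing by `κ(g)`, 1 exception 359a1/359b1 (two rank-1 curves, real-flag case B, `W(ℚ₂)[2] ≠ 0`); oriented pairs 43/43 (29 `κ`, 14 zero).
* kit j344687 (K51C three-way, MT48 bases `N < 10⁴`): class A ⟺ `4 ∤ a_ℓ(W) − a_ℓ(F)` 309/309; digit engines 2114/2114, 2966/2966, 6806/6806; the two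
  exceptions to ES-51K 916d1/916b1, 8244c1/8244e1 (case B, `n₂(W) = 1`, additive IV at 2).
* kit j344823 (K51B FULL, every mod-2 congruence class of optimal S₃ curves `N < 10⁴`: 5786 classes, 21 053 members, 0 error rows; rows sha16 `fc73897b0d5ce36b`): typed
  population of ES-51K **3145/3145** (`Δ_W < 0` 1736, multiplicative at 2 1172, supersingular at 2 237; β = 0 in 1393, κ(g) in 1752); outside `TameAtTwo`: 157 exceptions / 2523
  (all `Δ_W > 0`: 153 additive, 4 good ordinary at 2; 76 curves `W` in 24 conductors, smallest 916); all-rank-0 hygienic classes one mod-4 coset 569/585 (`Δ < 0`: 560/560);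
  ES-51P 762/762; Frobenius-digit engine checks 7 398 894 agree / 0 disagree, ν two-engine checks 180 700 / 0 bad.
* kit j344844 (K51D FULL, 7968 pairs: 2-adic root counts, Kodaira/c₂/f₂ at 2, real-flag case, generator component): ES-51K♮ population 1547/1547; the regime table above
  (rows sha16 `e0fa49002a080ca1`); see `CensusES51.md` §5–§7.
Why it might fail: ES-51K is a statement about ALL transposition primes, so one digit kills it; inside `TameAtTwo` the `Δ_W < 0 ∧ n₂(W) = 3` corner (32 pairs) and the
multiplicative / supersingular branches rest on the local span lemma at `2` (argued: Tate parametrisation / flatness, not proved); ES-51K♮ rests only on the odd-prime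
identifications `L_p(W) = L_p(F) ∋ res_p β` (S-lemma) and the parity lemma at `p = 2`.  Nearest print: Dummigan doi:10.5802/jtnb.548 (squaring map `Sel₂(E) → H¹(ℚ, Sym² E[2])` = dual tangent space, `2^R ∣ deg Φ`; no
congruent curve, no digit law); Mazur–Rubin «Selmer companion curves» (Trans. AMS 367 (2015), arXiv:1203.0620: when `Sel₂(E^χ) ≅ Sel₂(E'^χ)` for all `χ`
given `E[2] ≅ E'[2]`); Cremona–Mazur visibility (Exp. Math. 9 (2000)) / Agashe–Stein (rank of a congruent abelian variety explains Ш — geometric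
congruence inside `J₀(N)`); cell-internal: ES-29/ES-30 (the dictionary, level-RAISED pairs, 217 966 rows), MEMO-an §27.5 (26 prime-level pairs tagged
zero / point class / unit class, no law), AN-41a (Kummer direction realised in `𝕋(4N) ⊗ 𝔽₂[ε]` without a congruent curve).  WHY NOVEL (one sentence): nobody
has stated — let alone tested on every congruence class of conductor `< 10⁴` — that at MINIMAL level the mod-`4` defect between two mod-`2`-congruent
newforms is EXACTLY the `2`-Selmer class of the generator (dichotomy `{0, κ(g)}`), which makes the generator's Kummer class, and with ES-48M the class-A
twin set, readable from `a_ℓ (mod 4)` of a rank-`0` companion — and that the regimes where it holds / fails are dictated by a three-term local count at `{∞, 2}`.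
Beyond-print theorem: no (two kernel glues).  BSD is not proved here.
-/

open scoped Classical
open WeierstrassCurve NumberField Finset
open Literature.NumberTheory.EllipticCurves Literature.NumberTheory.EllipticCurves.ModularForms
open Summit.BirchSwinnertonDyer.Rank1Residual.F1Sign2 (LocallyTwoPowDivisible ShaTwoTrivial)
open Summit.BirchSwinnertonDyer.Rank1Residual.F1Sign2.FirstDerivativeAtTwo (primeStar)

set_option linter.dupNamespace false
set_option autoImplicit false

namespace Summit.BirchSwinnertonDyer.BirchSwinnertonDyer.Cruxes.RankOneAtTwoBigImageOddLocal.ES51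

/-! ## §0 Frames restated VERBATIM from the ES-48 workfile `AnalyticSupplyAtTwoES48.lean` (v1.2 @aa5140671717) -/

/-- `IsMinimalTwin W D W'`: `W'` is a globally minimal model of the quadratic twist `W^{(D)}` (ES-47 §6 / ES-48 §0, verbatim). -/
def IsMinimalTwin (W : WeierstrassCurve ℚ) (D : ℤ) (W' : WeierstrassCurve ℚ) : Prop :=
  ∃ C : WeierstrassCurve.VariableChange ℚ, C • W.quadraticTwist (D : ℚ) = W'

/-- `ShaAnTwoUnit W'` (ES-48 §1, verbatim): Miller's `#Ш_an(W')` is a rational `2`-adic unit. -/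
def ShaAnTwoUnit (W' : WeierstrassCurve ℚ) : Prop :=
  ∃ q : ℚ, shaAn W' = (q : ℂ) ∧ padicValRat 2 q = 0

/-- **ES-48M `FourCycleLawAtTwo`** (ES-48 §2, statement verbatim; CONJECTURE-GRADE; census MT48 1995/1995 + 1549/1549). -/
@[conjecture] def FourCycleLawAtTwo : Prop :=
  ∀ (W : WeierstrassCurve ℚ) [W.IsElliptic] [W.IsGloballyMinimal],
    ¬ W.HasCM → (∀ k : ℕ, W.HasSurjectiveModNGaloisRep ((2 ^ k : ℕ) : ℤ)) → Odd W.torsionOrder → Odd W.tamagawaProduct →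
    W.analyticRank = 1 → ShaTwoTrivial W →
    ∀ (g : (W.toAffine.baseChange ℚ).Point), (∀ Q : (W.toAffine.baseChange ℚ).Point, 2 • Q ≠ g) →
    ∀ (ℓ : ℕ) [Fact ℓ.Prime], ¬ ((ℓ : ℤ) ∣ 2 * (W.conductorNorm ℤ : ℤ)) → jacobiSym W.Δ.num ℓ = -1 → (W.Δ < 0 ∨ ℓ % 4 = 1) →
    ∀ (W₀ : WeierstrassCurve ℚ) [W₀.IsElliptic] [W₀.IsGloballyMinimal], IsMinimalTwin W (primeStar ℓ) W₀ →
      ((W₀.analyticRank = 0 ∧ ShaAnTwoUnit W₀) ↔ ¬ LocallyTwoPowDivisible W ℓ 1 g)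

/-! ## §1 ES-51 — the congruence predicate and the Kummer tangent law -/

/-- `CongruentModTwo W F`: `a_p(W) ≡ a_p(F) (mod 2)` at every prime `p ∤ 2·N_W·N_F` (good for both, so `frobeniusTrace = a_p`).  For curves with
`S₃` mod-2 image this is `W[2] ≅ F[2]` as Galois modules (Chebotarev + Brauer–Nesbitt: over `𝔽₂` the characteristic polynomial is `X² + āX + 1`,
and both sides are absolutely irreducible). [folklore] -/
def CongruentModTwo (W F : WeierstrassCurve ℚ) [W.IsGloballyMinimal] [F.IsGloballyMinimal] : Prop :=
  ∀ p : ℕ, p.Prime → ¬ ((p : ℤ) ∣ 2 * (W.conductorNorm ℤ : ℤ) * (F.conductorNorm ℤ : ℤ)) →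
    Even (W.frobeniusTrace p - F.frobeniusTrace p)

/-- `W` is "tame for the tangent law at 2": `Δ_W < 0` (then `H¹(ℝ, W[2]) = 0` and the deviation set is `Σ ⊂ {2}`), or `W` is multiplicative at `2`
(Tate curve: `L₂ = im H¹(ℚ₂, μ₂)` is canonical, `Σ ⊂ {∞}`), or `W` has good supersingular reduction at `2` (`a₂` even; flat condition, `Σ ⊂ {∞}`).  The excluded
regimes — `Δ_W > 0` with additive or good ordinary reduction at `2` — are exactly where the census finds exceptions (157/2523 hygienic pairs, N < 10⁴). -/
def TameAtTwo (W : WeierstrassCurve ℚ) [W.IsElliptic] [W.IsGloballyMinimal] : Prop :=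
  W.Δ < 0 ∨ W.HasMultiplicativeReductionAtPrime 2 ∨ (W.HasGoodReductionAtPrime 2 ∧ Even (W.frobeniusTrace 2))

/-- **ES-51K `KummerTangentDichotomyAtTwo` (LAW; census K51/K51B, kit j344645 / j344648 / j344823 / j344844; 0 exceptions in 3145 pairs, N < 10⁴).**
`W` on the 23715 slice with `Ш(W)[2] = 0` and `TameAtTwo W`, `g ∈ W(ℚ) ∖ 2W(ℚ)`; `F` globally minimal of the same conductor, congruent to `W` mod `2`, `#Sel₂(F) = 1`,
odd Tamagawa product.  Then EITHER the congruence lifts mod `4` (up to a quadratic twist) on the whole transposition locus — `4 ∣ a_ℓ(W) − a_ℓ(F)` for every prime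
`ℓ ∤ 2N` with `(Δ_W/ℓ) = −1` — OR its mod-`4` defect there is the Kummer class of `g`: `4 ∣ a_ℓ(W) − a_ℓ(F) ⟺ g ∈ 2W(ℚ_ℓ)` for every such `ℓ`
(`β(W,F) ∈ {0, κ(g)}`; `a_ℓ` is even at transposition primes, so the scalar twist is invisible there).  CENSUS N < 10⁴ on the typed population: `Δ_W < 0`: **1736/1736**;
multiplicative at 2: **1172/1172**; supersingular at 2: **237/237**; total **3145/3145** (β = 0 in 1393, β = κ(g) in 1752); WITHOUT `TameAtTwo`: 157 exceptions among 2523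
further hygienic pairs (all `Δ_W > 0`, 153 additive + 4 good ordinary at 2; e.g. 916d1/916b1, 2368q1/2368l1, 2089), WITHOUT `Odd F.tamagawaProduct`: 6 more with `Δ_W < 0`
(e.g. 8752b1/8752h1, `c₂(F) = 4`).  MECHANISM: module docstring (Greenberg–Wiles count `d(W,F)` odd; `TameAtTwo` ⇒ `#Σ ≤ 1` ⇒ `d = 1` when the local conditions at the
Σ-place are lines, plus the local span lemma).  Why it might fail: for `Δ_W < 0` with full 2-torsion over `ℚ₂` (`n₂ = 3`, 32 pairs in range) `d = 3` is not excluded by the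
count; for the multiplicative / supersingular branches the local span lemma at `2` (`res₂ β ∈ L₂`) is argued, not proved; one digit kills it.
[new: -es g40 §49; nearest print Dummigan doi:10.5802/jtnb.548 (visibility heuristics for congruent curves), Mazur–Rubin arXiv:1203.0620 (converse direction), MR 2010 parity lemmas] -/
@[conjecture] def KummerTangentDichotomyAtTwo : Prop :=
  ∀ (W : WeierstrassCurve ℚ) [W.IsElliptic] [W.IsGloballyMinimal],
    ¬ W.HasCM → (∀ k : ℕ, W.HasSurjectiveModNGaloisRep ((2 ^ k : ℕ) : ℤ)) → Odd W.torsionOrder → Odd W.tamagawaProduct →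
    W.analyticRank = 1 → ShaTwoTrivial W → TameAtTwo W →
    ∀ (g : (W.toAffine.baseChange ℚ).Point), (∀ Q : (W.toAffine.baseChange ℚ).Point, 2 • Q ≠ g) →
    ∀ (F : WeierstrassCurve ℚ) [F.IsElliptic] [F.IsGloballyMinimal],
      F.conductorNorm ℤ = W.conductorNorm ℤ → CongruentModTwo W F → Nat.card (F.selmerGroup (2 : ℤ)) = 1 → Odd F.tamagawaProduct →
      (∀ (ℓ : ℕ) [Fact ℓ.Prime], ¬ ((ℓ : ℤ) ∣ 2 * (W.conductorNorm ℤ : ℤ)) → jacobiSym W.Δ.num ℓ = -1 →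
          (4 : ℤ) ∣ W.frobeniusTrace ℓ - F.frobeniusTrace ℓ) ∨
      (∀ (ℓ : ℕ) [Fact ℓ.Prime], ¬ ((ℓ : ℤ) ∣ 2 * (W.conductorNorm ℤ : ℤ)) → jacobiSym W.Δ.num ℓ = -1 →
          ((4 : ℤ) ∣ W.frobeniusTrace ℓ - F.frobeniusTrace ℓ ↔ LocallyTwoPowDivisible W ℓ 1 g))

/-- `W(ℚ₂)[2] = 0`: the 2-division cubic `4x³ + b₂x² + 2b₄x + b₆` of `W` has no root in `ℚ₂` (equivalently `H⁰(ℚ₂, W[2]) = 0`, so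
`dim H¹(ℚ₂, W[2]) = 2` and the local Kummer condition at `2` is a line). -/
def NoTwoAdicTwoTorsion (W : WeierstrassCurve ℚ) : Prop :=
  ∀ x : ℚ_[2], ((W.map (algebraMap ℚ ℚ_[2])).twoTorsionPolynomial).toPoly.eval x ≠ 0

/-- **ES-51K♮ `KummerTangentDichotomyAtTwoSharp` — the THEOREM-CANDIDATE core of ES-51K**: the branch `Δ_W < 0 ∧ W(ℚ₂)[2] = 0` (census N < 10⁴: **1547/1547**).
Proof sketch (what is print / argued / open): with `V = W[2] = F[2]`, (1) odd `c_p` on both sides ⇒ at every odd multiplicative `p` the module `V` is ramified and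
`L_p(W) = L_p(F) = im(H¹(ℚ_p, μ₂) → H¹(ℚ_p, V))` (canonical; unramified quadratic twists do not move `L_p`, [corpus:paper:anon2010-ranks-twists… p7 Lemma 2.10]), and at
every odd additive `p`, `W(ℚ_p)[2] = 0` so `H¹(ℚ_p, V) = 0`; `Δ_W < 0` ⇒ `H¹(ℝ, V) = 0`; hence `Σ ⊂ {2}`; (2) the Greenberg–Wiles / parity count: `d(W,F) = d₂ ≡
dim Sel₂(W) − dim Sel₂(F) = 1 (mod 2)` [MR 2010 Thm 2.7 / Lemma 2.9, valid at `p = 2`], and `NoTwoAdicTwoTorsion W` ⇒ `dim H¹(ℚ₂, V) = 2`, `d₂ ≤ 1` ⇒ `d₂ = 1` ⇒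
`L₂(W) ≠ L₂(F)` ⇒ `L₂(W) + L₂(F) = H¹(ℚ₂, V)` (NO local span lemma needed at `2`) ⇒ `β ∈ H¹_{L_W + L_F} ⊇ Sel₂(W) = ⟨κ(g)⟩` with equality by the count (relaxed minus strict
= 1, strict ⊂ Sel₂(F) = 0); the only non-formal local input left is (1) at odd multiplicative primes (`res_p β ∈ im H¹(μ₂)`, the S-lemma of §6 of the census).  The earlier
form with `NoTwoAdicTwoTorsion` alone is FALSE (census: 125 exceptions with `W(ℚ₂)[2] = 0`, all additive at `2` with `Δ_W > 0`, e.g. 2368q1/2368l1 — the local span lemma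
fails at an additive `2`). -/
@[conjecture] def KummerTangentDichotomyAtTwoSharp : Prop :=
  ∀ (W : WeierstrassCurve ℚ) [W.IsElliptic] [W.IsGloballyMinimal],
    ¬ W.HasCM → (∀ k : ℕ, W.HasSurjectiveModNGaloisRep ((2 ^ k : ℕ) : ℤ)) → Odd W.torsionOrder → Odd W.tamagawaProduct →
    W.analyticRank = 1 → ShaTwoTrivial W → W.Δ < 0 → NoTwoAdicTwoTorsion W →
    ∀ (g : (W.toAffine.baseChange ℚ).Point), (∀ Q : (W.toAffine.baseChange ℚ).Point, 2 • Q ≠ g) →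
    ∀ (F : WeierstrassCurve ℚ) [F.IsElliptic] [F.IsGloballyMinimal],
      F.conductorNorm ℤ = W.conductorNorm ℤ → CongruentModTwo W F → Nat.card (F.selmerGroup (2 : ℤ)) = 1 → Odd F.tamagawaProduct →
      (∀ (ℓ : ℕ) [Fact ℓ.Prime], ¬ ((ℓ : ℤ) ∣ 2 * (W.conductorNorm ℤ : ℤ)) → jacobiSym W.Δ.num ℓ = -1 →
          (4 : ℤ) ∣ W.frobeniusTrace ℓ - F.frobeniusTrace ℓ) ∨
      (∀ (ℓ : ℕ) [Fact ℓ.Prime], ¬ ((ℓ : ℤ) ∣ 2 * (W.conductorNorm ℤ : ℤ)) → jacobiSym W.Δ.num ℓ = -1 →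
          ((4 : ℤ) ∣ W.frobeniusTrace ℓ - F.frobeniusTrace ℓ ↔ LocallyTwoPowDivisible W ℓ 1 g))

/-- **ES-51P `SelmerParityRigidityAtTwo`** (LAW, census K51B4 kit j344823, N < 10⁴: **762/762 classes** — 548 multiplicative at 2, 214 supersingular at 2 — have ALL
hygienic members of equal `dim Sel₂`, while for `Δ < 0` additive / ordinary at 2 mixed parities occur in 137/399 resp. 23/190 classes and for `Δ > 0` in the majority).
MECHANISM (= the `Σ = ∅` case of the Greenberg–Wiles count of ES-51): `Δ < 0` kills the place `∞`; odd Tamagawa numbers make the Kummer lines agree at every odd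
prime; at `2`, multiplicative reduction (Tate curves: `L₂ = im H¹(ℚ₂, μ₂)`, canonical) or supersingular reduction (`V|_{G_{ℚ₂}}` irreducible; flat condition) makes
`L₂(W) = L₂(F)`; hence `Sel₂(W) = Sel₂(F)` inside `H¹(ℚ, V)`.  Typed as equality of cardinalities.  Consequence for the -es line: a rank-1 slice curve with `Δ < 0` that is
multiplicative or supersingular at `2` has NO `Sel₂`-trivial congruent companion of the same conductor (the ES-51S supply reading then needs a companion of another level).
Why it might fail: the supersingular flat-uniqueness step at `2` (`e = 1 = p − 1`, outside Raynaud's range) is the one non-formal input; a class with a 4-torsion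
obstruction in `Ш` of one member only would break the equality of cardinalities but not of parities.  [new: -es g40 §49; theorem-candidate modulo the local lemma at 2] -/
@[conjecture] def SelmerParityRigidityAtTwo : Prop :=
  ∀ (W : WeierstrassCurve ℚ) [W.IsElliptic] [W.IsGloballyMinimal],
    W.HasSurjectiveModNGaloisRep 2 → Odd W.torsionOrder → Odd W.tamagawaProduct → W.Δ < 0 →
    (W.HasMultiplicativeReductionAtPrime 2 ∨ (W.HasGoodReductionAtPrime 2 ∧ Even (W.frobeniusTrace 2))) →
    ∀ (F : WeierstrassCurve ℚ) [F.IsElliptic] [F.IsGloballyMinimal],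
      F.conductorNorm ℤ = W.conductorNorm ℤ → CongruentModTwo W F → Odd F.torsionOrder → Odd F.tamagawaProduct →
      Nat.card (W.selmerGroup (2 : ℤ)) = Nat.card (F.selmerGroup (2 : ℤ))

theorem sharp_of_dichotomy (h : KummerTangentDichotomyAtTwo) : KummerTangentDichotomyAtTwoSharp := by
  intro W _ _ hcm hsurj htor htam hrk hsha hneg _hn2 g hg F _ _ hN hcong hsel htamF
  exact h W hcm hsurj htor htam hrk hsha (Or.inl hneg) g hg F hN hcong hsel htamF

/-- **ES-51S `SupplyIsModFourDefectAtTwo` (CONJECTURE-GRADE; = ES-48M ∧ ES-51K by the kernel glue `supplyIsModFourDefect_of_laws`).**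
Same frame; if the congruence `W ≡ F (mod 2)` does NOT lift mod `4` at some transposition prime `ℓ₀ ∤ 2N`, then at every transposition prime
`ℓ ∤ 2N` in the even-sign role (`Δ_W < 0 ∨ ℓ ≡ 1 (4)`) and for every globally minimal model `W₀` of `W^{(ℓ*)}`:
`(r_an(W₀) = 0 ∧ #Ш_an(W₀) odd) ⟺ 4 ∤ a_ℓ(W) − a_ℓ(F)` — the class-A twins are the mod-`4` incongruence primes.  (37a1 vs 37b1, MT48 rows: 27/27.)
[new: -es g40 §49; conjecture-grade; implied by ES-48M + ES-51K] -/
@[conjecture] def SupplyIsModFourDefectAtTwo : Prop :=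
  ∀ (W : WeierstrassCurve ℚ) [W.IsElliptic] [W.IsGloballyMinimal],
    ¬ W.HasCM → (∀ k : ℕ, W.HasSurjectiveModNGaloisRep ((2 ^ k : ℕ) : ℤ)) → Odd W.torsionOrder → Odd W.tamagawaProduct →
    W.analyticRank = 1 → ShaTwoTrivial W → TameAtTwo W →
    ∀ (g : (W.toAffine.baseChange ℚ).Point), (∀ Q : (W.toAffine.baseChange ℚ).Point, 2 • Q ≠ g) →
    ∀ (F : WeierstrassCurve ℚ) [F.IsElliptic] [F.IsGloballyMinimal],
      F.conductorNorm ℤ = W.conductorNorm ℤ → CongruentModTwo W F → Nat.card (F.selmerGroup (2 : ℤ)) = 1 → Odd F.tamagawaProduct →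
      (∃ (ℓ₀ : ℕ) (_ : Fact ℓ₀.Prime), ¬ ((ℓ₀ : ℤ) ∣ 2 * (W.conductorNorm ℤ : ℤ)) ∧ jacobiSym W.Δ.num ℓ₀ = -1 ∧
          ¬ (4 : ℤ) ∣ W.frobeniusTrace ℓ₀ - F.frobeniusTrace ℓ₀) →
      ∀ (ℓ : ℕ) [Fact ℓ.Prime], ¬ ((ℓ : ℤ) ∣ 2 * (W.conductorNorm ℤ : ℤ)) → jacobiSym W.Δ.num ℓ = -1 → (W.Δ < 0 ∨ ℓ % 4 = 1) →
      ∀ (W₀ : WeierstrassCurve ℚ) [W₀.IsElliptic] [W₀.IsGloballyMinimal], IsMinimalTwin W (primeStar ℓ) W₀ →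
        ((W₀.analyticRank = 0 ∧ ShaAnTwoUnit W₀) ↔ ¬ (4 : ℤ) ∣ W.frobeniusTrace ℓ - F.frobeniusTrace ℓ)

/-! ## §2 Kernel glue (sorry-free): ES-48M ∧ ES-51K ⟹ ES-51S, and the one-prime reading -/

/-- GLUE: the four-cycle law and the Kummer tangent dichotomy give the supply/defect identification. -/
theorem supplyIsModFourDefect_of_laws (h48 : FourCycleLawAtTwo) (h51 : KummerTangentDichotomyAtTwo) :
    SupplyIsModFourDefectAtTwo := by
  intro W _ _ hcm hsurj htor htam hrk hsha htame g hg F _ _ hN hcong hsel htamF hex ℓ _ hℓ htr hrole W₀ _ _ htwin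
  obtain ⟨ℓ₀, hℓ₀p, hℓ₀, htr₀, hne₀⟩ := hex
  have hdich := h51 W hcm hsurj htor htam hrk hsha htame g hg F hN hcong hsel htamF
  have hbranch : ∀ (ℓ : ℕ) [Fact ℓ.Prime], ¬ ((ℓ : ℤ) ∣ 2 * (W.conductorNorm ℤ : ℤ)) → jacobiSym W.Δ.num ℓ = -1 →
      ((4 : ℤ) ∣ W.frobeniusTrace ℓ - F.frobeniusTrace ℓ ↔ LocallyTwoPowDivisible W ℓ 1 g) := by
    rcases hdich with hall | hsec
    · exact absurd (@hall ℓ₀ hℓ₀p hℓ₀ htr₀) hne₀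
    · exact hsec
  have h1 := h48 W hcm hsurj htor htam hrk hsha g hg ℓ hℓ htr hrole W₀ htwin
  have h2 := @hbranch ℓ _ hℓ htr
  exact h1.trans (not_congr h2.symm)

/-- ONE-PRIME READING (pure logic): under ES-51K, a single transposition prime `ℓ₀` where `4 ∤ a(W) − a(F)` puts the pair in the Kummer branch,
so at every transposition prime `ℓ ∤ 2N`: `g ∈ 2W(ℚ_ℓ) ⟺ 4 ∣ a_ℓ(W) − a_ℓ(F)` — the generator's local halvability read off two `a_ℓ`'s. -/
theorem halvability_iff_modFour_of_dichotomy (h51 : KummerTangentDichotomyAtTwo)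
    (W : WeierstrassCurve ℚ) [W.IsElliptic] [W.IsGloballyMinimal]
    (hcm : ¬ W.HasCM) (hsurj : ∀ k : ℕ, W.HasSurjectiveModNGaloisRep ((2 ^ k : ℕ) : ℤ)) (htor : Odd W.torsionOrder)
    (htam : Odd W.tamagawaProduct) (hrk : W.analyticRank = 1) (hsha : ShaTwoTrivial W) (htame : TameAtTwo W)
    (g : (W.toAffine.baseChange ℚ).Point) (hg : ∀ Q : (W.toAffine.baseChange ℚ).Point, 2 • Q ≠ g)
    (F : WeierstrassCurve ℚ) [F.IsElliptic] [F.IsGloballyMinimal]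
    (hN : F.conductorNorm ℤ = W.conductorNorm ℤ) (hcong : CongruentModTwo W F) (hsel : Nat.card (F.selmerGroup (2 : ℤ)) = 1)
    (htamF : Odd F.tamagawaProduct)
    (ℓ₀ : ℕ) [Fact ℓ₀.Prime] (hℓ₀ : ¬ ((ℓ₀ : ℤ) ∣ 2 * (W.conductorNorm ℤ : ℤ))) (htr₀ : jacobiSym W.Δ.num ℓ₀ = -1)
    (hne₀ : ¬ (4 : ℤ) ∣ W.frobeniusTrace ℓ₀ - F.frobeniusTrace ℓ₀)
    (ℓ : ℕ) [Fact ℓ.Prime] (hℓ : ¬ ((ℓ : ℤ) ∣ 2 * (W.conductorNorm ℤ : ℤ))) (htr : jacobiSym W.Δ.num ℓ = -1) :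
    LocallyTwoPowDivisible W ℓ 1 g ↔ (4 : ℤ) ∣ W.frobeniusTrace ℓ - F.frobeniusTrace ℓ := by
  rcases h51 W hcm hsurj htor htam hrk hsha htame g hg F hN hcong hsel htamF with hall | hsec
  · exact absurd (@hall ℓ₀ _ hℓ₀ htr₀) hne₀
  · exact (@hsec ℓ _ hℓ htr).symm

end Summit.BirchSwinnertonDyer.BirchSwinnertonDyer.Cruxes.RankOneAtTwoBigImageOddLocal.ES51
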